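import Mathlib
import Summits.NavierStokesRegularity.NavierStokesRegularity.Theorems.FilamentSkeletonRssStadiumQuarterCore
import Summits.NavierStokesRegularity.NavierStokesRegularity.Theorems.FilamentSkeletonRssStadiumStripPropagation
import Summits.NavierStokesRegularity.NavierStokesRegularity.Theorems.FilamentSkeletonRssAnalyticStripStadiumDefs

/-!
# Route `FilamentSkeletonRss` · cruxes `SkeletonJ1L` (stmt-NavierStokesRegularity-23296, registered stub `stub_tangentSkeletonL` ≡
# `TangentSkeletonNearStraightL`, stmt-23320) · line `child_tangent_analytic_strip_L` (b0b56c52900dd90a) —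
# THE REGISTERED STUB `stub_stripPropagation : StripPropagation` AT THE REGISTERED QUARTER WIDTH, PROVED

`strip_propagation_quarter` is the δ-unfolded registered text (`Theorems.AnalyticStripStadium.stripPropagation_iff`, `Iff.rfl`) — output half-width
`cs√Γ/4`, NO retype — proved from the per-filament quarter core `Theorems.StadiumQuarterCore.quarter_core` (symmetric tent: freeze/holomorphy
`Theorems.StadiumTentNhds`, real trace `Theorems.StadiumTentReal`, explicit bound `Theorems.StadiumOwnTentBound`; partners `Theorems.StadiumPartnerPiece`)
by the real Γ-asymptotics of its explicit bound (`quarter_bound_abstract`: `B_tent + B_partner ≤ C₀(cs,ρ)·log Γ/√Γ`; `quarter_log_term_le`;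
`quarter_plateau_condition`; `Theorems.StadiumStripPropagation.coeff_sum_le` / `gamma_facts`) and the quantifier packaging of the /16 file.
`stub_stripPropagation : StripPropagation` is then the registered stub of BOTH twins (`TangentSkeletonNearStraight` 28295 /
`TangentSkeletonNearStraightL` 23320) BY NAME over the Theorems-side verbatim copy of the statement.
HONEST FRAMING: this closes ONE registered stub (the strip-propagation step) of the line `child_tangent_analytic_strip_L` for a HYPOTHETICAL filament
skeleton on the NEGATIVE side of a MODEL route; the line's other stub `stub_analyticClosingL : AnalyticNewtonClosingL` (the heart) is untouched,
`TangentSkeletonNearStraightL` / `SkeletonJ1L` stay OPEN, and nothing here bears on Navier–Stokes regularity or blow-up.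
`--supports stmt-NavierStokesRegularity-23320` (≡ stub `stub_tangentSkeletonL` of 23296).
-/

set_option linter.dupNamespace false

noncomputable section

namespace Summit.NavierStokesRegularity.NavierStokesRegularity.Theorems.StadiumStripPropagationQuarterProof

open Set MeasureTheory Complex
open scoped InnerProductSpace
open Literature.Analysis.FluidPDE
open Summit.NavierStokesRegularity.NavierStokesRegularity.Theorems.StadiumQuarterCore
open Summit.NavierStokesRegularity.NavierStokesRegularity.Theorems.StadiumStripPropagation
open Summit.NavierStokesRegularity.NavierStokesRegularity.Theorems.AnalyticStripStadium

/-- `9/10 ≤ √(21/25) ≤ 1`. [folklore] -/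
theorem sqrt_21_25_bounds : 9 / 10 ≤ √(21 / 25 : ℝ) ∧ √(21 / 25 : ℝ) ≤ 1 :=
  ⟨(Real.le_sqrt' (by norm_num)).mpr (by norm_num), Real.sqrt_le_one.mpr (by norm_num)⟩

/-- The explicit constant `C₀(cs, ρ)` of the quarter asymptotics is positive. [folklore] -/
theorem C0q_pos {cs ρ : ℝ} (hcs : 0 < cs) (hρ : 0 < ρ) :
    0 < 640 * (Real.pi / cs) + (16 / (0.007 : ℝ) ^ 3) * (1 / cs) + (32000 / 189) * (1 / cs) + (78080 / 63) * (Real.pi / ρ) := by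
  positivity

/-- **Γ-asymptotics of `B_tent + B_partner`, abstract form.**  With `hs = cs·r`, `d₀ = ρ·r` (`r = √Γ ≥ 1`, `ℓ = log Γ ≥ 1`) and the plateau
logarithm bounded by `1/3 + lg ≤ 2ℓ`, the explicit per-unit-circulation bound of `quarter_core` is `≤ C₀(cs,ρ)·ℓ/r`. [folklore] -/
theorem quarter_bound_abstract {cs ρ r ℓ hs d₀ lg : ℝ} (hcs : 0 < cs) (hρ : 0 < ρ) (hr1 : 1 ≤ r) (hℓ1 : 1 ≤ ℓ)
    (hh : hs = cs * r) (hd : d₀ = ρ * r) (hlg : 1 / 3 + lg ≤ 2 * ℓ) :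
    (2 * (160 * (Real.pi / (1 * (hs / 2)))) + 2 * (((0.007 * hs) ^ 2) ^ (-(3/2 : ℝ)) * (8 * hs) * hs) +
        2 * (4 * (2 * ((2 / (hs / 2)) * (hs / 5) ^ 3)) * ((1/3 + lg) / ((21 / 25 : ℝ) * (hs / 5) ^ 2) ^ (3/2 : ℝ)))) +
      5 * (61 * 16 / 9) * (Real.pi / ((7 / 16) * d₀)) ≤
      (640 * (Real.pi / cs) + (16 / (0.007 : ℝ) ^ 3) * (1 / cs) + (32000 / 189) * (1 / cs) + (78080 / 63) * (Real.pi / ρ)) * (ℓ / r) := by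
  have hr0 : 0 < r := by linarith
  have hℓ0 : 0 < ℓ := by linarith
  have hhs : 0 < hs := by rw [hh]; positivity
  have hd0 : 0 < d₀ := by rw [hd]; positivity
  have hℓr : 1 / r ≤ ℓ / r := div_le_div_of_nonneg_right hℓ1 hr0.le
  obtain ⟨hs9, hs1⟩ := sqrt_21_25_bounds
  -- T1 (feet)
  have hT1 : 2 * (160 * (Real.pi / (1 * (hs / 2)))) ≤ 640 * (Real.pi / cs) * (ℓ / r) := by
    have e1 : 2 * (160 * (Real.pi / (1 * (hs / 2)))) = 640 * (Real.pi / cs) * (1 / r) := by rw [hh]; field_simp; ring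
    rw [e1]; exact mul_le_mul_of_nonneg_left hℓr (by positivity)
  -- T2 (descents)
  have hT2 : 2 * (((0.007 * hs) ^ 2) ^ (-(3/2 : ℝ)) * (8 * hs) * hs) ≤ (16 / (0.007 : ℝ) ^ 3) * (1 / cs) * (ℓ / r) := by
    have ha : 0 < (0.007 : ℝ) * hs := by positivity
    have hpow : ((0.007 * hs) ^ 2) ^ (-(3/2 : ℝ)) = ((0.007 * hs) ^ 2 * (0.007 * hs))⁻¹ := by
      rw [rpow_neg_three_halves (by positivity), Real.sqrt_sq ha.le]
    have e2 : 2 * (((0.007 * hs) ^ 2) ^ (-(3/2 : ℝ)) * (8 * hs) * hs) = (16 / (0.007 : ℝ) ^ 3) * (1 / cs) * (1 / r) := by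
      rw [hpow, hh]; field_simp; ring
    rw [e2]; exact mul_le_mul_of_nonneg_left hℓr (by positivity)
  -- T3 (plateau)
  have hT3 : 2 * (4 * (2 * ((2 / (hs / 2)) * (hs / 5) ^ 3)) * ((1/3 + lg) / ((21 / 25 : ℝ) * (hs / 5) ^ 2) ^ (3/2 : ℝ))) ≤
      (32000 / 189) * (1 / cs) * (ℓ / r) := by
    have h5 : 0 ≤ hs / 5 := by positivity
    have hsq : √((21 / 25 : ℝ) * (hs / 5) ^ 2) = √(21 / 25 : ℝ) * (hs / 5) := by
      rw [Real.sqrt_mul (by norm_num), Real.sqrt_sq h5]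
    have hpow : ((21 / 25 : ℝ) * (hs / 5) ^ 2) ^ (3/2 : ℝ) = ((21 / 25 : ℝ) * (hs / 5) ^ 2) * (√(21 / 25 : ℝ) * (hs / 5)) := by
      rw [rpow_three_halves (by positivity), hsq]
    have hs0 : 0 < √(21 / 25 : ℝ) := by linarith
    have e3 : 2 * (4 * (2 * ((2 / (hs / 2)) * (hs / 5) ^ 3)) * ((1/3 + lg) / ((21 / 25 : ℝ) * (hs / 5) ^ 2) ^ (3/2 : ℝ))) =
        (1600 / 21) * ((1/3 + lg) / (√(21 / 25 : ℝ) * hs)) := by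
      rw [hpow]; field_simp; ring
    rw [e3]
    have hden : 0 < √(21 / 25 : ℝ) * hs := by positivity
    have hq1 : (1/3 + lg) / (√(21 / 25 : ℝ) * hs) ≤ (2 * ℓ) / (√(21 / 25 : ℝ) * hs) := div_le_div_of_nonneg_right hlg hden.le
    have hq2 : (2 * ℓ) / (√(21 / 25 : ℝ) * hs) ≤ (2 * ℓ) / ((9 / 10) * hs) :=
      div_le_div_of_nonneg_left (by positivity) (by positivity) (mul_le_mul_of_nonneg_right hs9 hhs.le)
    have e3' : (1600 / 21 : ℝ) * ((2 * ℓ) / ((9 / 10) * hs)) = (32000 / 189) * (1 / cs) * (ℓ / r) := by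
      rw [hh]; field_simp; ring
    calc (1600 / 21 : ℝ) * ((1/3 + lg) / (√(21 / 25 : ℝ) * hs)) ≤ (1600 / 21) * ((2 * ℓ) / ((9 / 10) * hs)) :=
          mul_le_mul_of_nonneg_left (hq1.trans hq2) (by norm_num)
      _ = (32000 / 189) * (1 / cs) * (ℓ / r) := e3'
  -- T4 (partners)
  have hT4 : 5 * (61 * 16 / 9) * (Real.pi / ((7 / 16) * d₀)) ≤ (78080 / 63) * (Real.pi / ρ) * (ℓ / r) := by
    have e4 : 5 * (61 * 16 / 9) * (Real.pi / ((7 / 16) * d₀)) = (78080 / 63) * (Real.pi / ρ) * (1 / r) := by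
      rw [hd]; field_simp; ring
    rw [e4]; exact mul_le_mul_of_nonneg_left hℓr (by positivity)
  have hsum := add_le_add (add_le_add (add_le_add hT1 hT2) hT3) hT4
  refine hsum.trans (le_of_eq ?_)
  ring

/-- The plateau logarithm: `lg = log((1−0)·√((21/25)(cs√Γ/5)²)/m)` satisfies `1/3 + lg ≤ 2 log Γ` once
`log Γ ≥ 1/3 + |log(√(21/25)·cs/(5m))|`. [folklore] -/
theorem quarter_log_term_le {cs Γ m : ℝ} (hcs : 0 < cs) (hm : 0 < m) (hΓ1 : 1 ≤ Γ) (hℓ1 : 1 ≤ Real.log Γ)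
    (hℓC : 1 / 3 + |Real.log (√(21 / 25 : ℝ) * cs / (5 * m))| ≤ Real.log Γ) :
    1 / 3 + Real.log ((1 - 0) * √((21 / 25 : ℝ) * (cs * √Γ / 5) ^ 2) / m) ≤ 2 * Real.log Γ := by
  obtain ⟨hs9, -⟩ := sqrt_21_25_bounds
  have hs0 : 0 < √(21 / 25 : ℝ) := by linarith
  have hΓ0 : 0 < Γ := by linarith
  have hr0 : 0 < √Γ := Real.sqrt_pos.mpr hΓ0
  have h5 : 0 ≤ cs * √Γ / 5 := by positivity
  have hsq : √((21 / 25 : ℝ) * (cs * √Γ / 5) ^ 2) = √(21 / 25 : ℝ) * (cs * √Γ / 5) := by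
    rw [Real.sqrt_mul (by norm_num), Real.sqrt_sq h5]
  have e : (1 - 0) * √((21 / 25 : ℝ) * (cs * √Γ / 5) ^ 2) / m = (√(21 / 25 : ℝ) * cs / (5 * m)) * √Γ := by
    rw [hsq]; field_simp; ring
  have hK : 0 < √(21 / 25 : ℝ) * cs / (5 * m) := by positivity
  rw [e, Real.log_mul hK.ne' hr0.ne', Real.log_sqrt hΓ0.le]
  have h1 := le_abs_self (Real.log (√(21 / 25 : ℝ) * cs / (5 * m)))
  linarith

/-- The plateau log-condition of `quarter_core` (`m/√((21/25)(hs/5)²) ≤ 1 − 0`, `hs = cs√Γ`) holds once `√Γ ≥ 50m/(9cs)`. [folklore] -/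
theorem quarter_plateau_condition {cs Γ m : ℝ} (hcs : 0 < cs) (_hm : 0 < m) (hΓ : 0 < Γ) (hr : 50 * m / (9 * cs) ≤ √Γ) :
    m / √((21 / 25 : ℝ) * (cs * √Γ / 5) ^ 2) ≤ 1 - 0 := by
  obtain ⟨hs9, -⟩ := sqrt_21_25_bounds
  have hr0 : 0 < √Γ := Real.sqrt_pos.mpr hΓ
  have h5 : 0 ≤ cs * √Γ / 5 := by positivity
  have hsq : √((21 / 25 : ℝ) * (cs * √Γ / 5) ^ 2) = √(21 / 25 : ℝ) * (cs * √Γ / 5) := by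
    rw [Real.sqrt_mul (by norm_num), Real.sqrt_sq h5]
  rw [hsq, sub_zero]
  have hden : 0 < √(21 / 25 : ℝ) * (cs * √Γ / 5) := by positivity
  rw [div_le_one hden]
  have h1 : (9 / 10) * (cs * √Γ / 5) ≤ √(21 / 25 : ℝ) * (cs * √Γ / 5) := mul_le_mul_of_nonneg_right hs9 h5
  have h2 : m ≤ (9 / 10) * (cs * √Γ / 5) := by
    rw [div_le_iff₀ (by positivity : (0:ℝ) < 9 * cs)] at hr
    nlinarith
  linarith

/-- **STRIP PROPAGATION at the REGISTERED quarter width** — the δ-unfolded registered text of `StripPropagation` (both twins), proved. [folklore] -/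
theorem strip_propagation_quarter :
    ∀ (N : ℕ) (ρ K Λ Rb cg θ₀ KA cs : ℝ), 0 < N → 0 < ρ → 0 < Λ → 0 < Rb → Rb ≤ 1/2 → 0 < cg → 0 < θ₀ → 0 < KA →
    0 < cs → 8 * cs ≤ ρ →
    ∃ (Cu Γ₀ : ℝ), 0 < Cu ∧ ∀ Γ : ℝ, Γ₀ ≤ Γ →
      ∀ (γ : Fin N → ℝ) (X : Fin N → ℝ → EuclideanSpace ℝ (Fin 3)) (c : Fin N → ℝ) (Aa : Fin N → ℝ → ℝ)
        (u : (Fin N → ℝ → EuclideanSpace ℝ (Fin 3)) → EuclideanSpace ℝ (Fin 3) → EuclideanSpace ℝ (Fin 3)),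
        (∀ Z y, u Z y = ∑ k, (Γ*γ k/(4*Real.pi))•∫ σ:ℝ, ((‖y-Z k σ‖^2+Real.exp (-(1+Real.eulerMascheroniConstant-Real.log 2))*Aa k σ)^(3/2:ℝ))⁻¹•cross (deriv (Z k) σ) (y-Z k σ)) →
        (∀ j, |γ j| ≤ θ₀⁻¹) →
        (∀ j, ContDiff ℝ 2 (X j) ∧ (∀ τ, ‖deriv (X j) τ‖ = 1) ∧ (∀ τ, ‖iteratedDeriv 2 (X j) τ‖ * √Γ ≤ K) ∧
          ∀ τ σ, ‖deriv (X j) τ - deriv (X j) σ‖ ≤ Rb) →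
        (∀ j k, j ≠ k → ∀ τ σ, ρ * √Γ ≤ ‖X j τ - X k σ‖) →
        (∀ j τ σ, ρ * √Γ ≤ |τ - σ| → cg * ρ * √Γ ≤ ‖X j τ - X j σ‖) →
        (∀ j, Differentiable ℝ (Aa j) ∧ (∀ τ, Λ⁻¹ ≤ Aa j τ) ∧ ∀ τ, Aa j τ ≤ KA * (1 + Γ + ‖X j τ‖ ^ 2)) →
        (∀ j, ∃ F : ℂ → (Fin 3 → ℂ),
          DifferentiableOn ℂ F {z : ℂ | |z.im| < cs * √Γ ∧ |z.re - c j| < Rb * √(Γ * Real.log Γ) + cs * √Γ} ∧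
          (∀ t : ℝ, (t : ℂ) ∈ {z : ℂ | |z.im| < cs * √Γ ∧ |z.re - c j| < Rb * √(Γ * Real.log Γ) + cs * √Γ} →
            F t = fun i => ((⟪X j t, EuclideanSpace.single i (1:ℝ)⟫_ℝ : ℝ) : ℂ)) ∧
          ∀ z ∈ {z : ℂ | |z.im| < cs * √Γ ∧ |z.re - c j| < Rb * √(Γ * Real.log Γ) + cs * √Γ}, ‖deriv F z‖ ≤ 2) →
        (∀ j, ∃ G : ℂ → ℂ,
          DifferentiableOn ℂ G {z : ℂ | |z.im| < cs * √Γ ∧ |z.re - c j| < Rb * √(Γ * Real.log Γ) + cs * √Γ} ∧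
          (∀ t : ℝ, (t : ℂ) ∈ {z : ℂ | |z.im| < cs * √Γ ∧ |z.re - c j| < Rb * √(Γ * Real.log Γ) + cs * √Γ} →
            G t = ((Aa j t : ℝ) : ℂ)) ∧
          ∀ z ∈ {z : ℂ | |z.im| < cs * √Γ ∧ |z.re - c j| < Rb * √(Γ * Real.log Γ) + cs * √Γ},
            Aa j z.re / 2 ≤ (G z).re ∧ ‖G z‖ ≤ 2 * Aa j z.re) →
        ∀ j, ∃ U : ℂ → (Fin 3 → ℂ),
          DifferentiableOn ℂ U {z : ℂ | |z.im| < cs * √Γ / 4 ∧ |z.re - c j| < Rb * √(Γ * Real.log Γ) + cs * √Γ / 4} ∧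
          (∀ t : ℝ, (t : ℂ) ∈ {z : ℂ | |z.im| < cs * √Γ / 4 ∧ |z.re - c j| < Rb * √(Γ * Real.log Γ) + cs * √Γ / 4} →
            U t = fun i => ((⟪u X (X j t), EuclideanSpace.single i (1:ℝ)⟫_ℝ : ℝ) : ℂ)) ∧
          ∀ z ∈ {z : ℂ | |z.im| < cs * √Γ / 4 ∧ |z.re - c j| < Rb * √(Γ * Real.log Γ) + cs * √Γ / 4},
            ‖U z‖ ≤ Cu * √Γ * Real.log Γ := by
  intro N ρ K Λ Rb cg θ₀ KA cs hN hρ hΛ hRb hRb2 hcg hθ hKA hcs h8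
  -- the constants
  set m : ℝ := √(Real.exp (-(1 + Real.eulerMascheroniConstant - Real.log 2)) / (2 * Λ)) with hmdef
  have hm0 : 0 < m := Real.sqrt_pos.mpr (by positivity)
  set Cn : ℝ := 1 / 3 + |Real.log (√(21 / 25 : ℝ) * cs / (5 * m))| with hCn
  set C₀ : ℝ := 640 * (Real.pi / cs) + (16 / (0.007 : ℝ) ^ 3) * (1 / cs) + (32000 / 189) * (1 / cs) + (78080 / 63) * (Real.pi / ρ)
    with hC₀
  have hC₀pos : 0 < C₀ := C0q_pos hcs hρ
  have hN' : (0:ℝ) < N := Nat.cast_pos.mpr hN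
  set Cu : ℝ := (N : ℝ) * θ₀⁻¹ / (4 * Real.pi) * C₀ with hCu
  have hCupos : 0 < Cu := mul_pos (div_pos (mul_pos hN' (inv_pos.mpr hθ)) (by positivity)) hC₀pos
  refine ⟨Cu, max (Real.exp (max 1 Cn)) ((max 1 (50 * m / (9 * cs))) ^ 2), hCupos, ?_⟩
  intro Γ hΓ γ X c Aa u hu hγ hX hsep hca hA hF hG j
  -- consequences of `Γ ≥ Γ₀`
  have hΓexp : Real.exp (max 1 Cn) ≤ Γ := le_trans (le_max_left _ _) hΓ
  have hΓsq : (max 1 (50 * m / (9 * cs))) ^ 2 ≤ Γ := le_trans (le_max_right _ _) hΓ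
  have hΓpos : 0 < Γ := lt_of_lt_of_le (Real.exp_pos _) hΓexp
  have hΓ1 : 1 ≤ Γ := by
    have h1 : (1:ℝ) + 1 ≤ Real.exp 1 := Real.add_one_le_exp 1
    have h2 : Real.exp 1 ≤ Real.exp (max 1 Cn) := Real.exp_le_exp.mpr (le_max_left _ _)
    linarith
  have hℓ : max 1 Cn ≤ Real.log Γ := by
    rw [Real.le_log_iff_exp_le hΓpos]; exact hΓexp
  have hℓ1 : 1 ≤ Real.log Γ := le_trans (le_max_left _ _) hℓ
  have hℓC : Cn ≤ Real.log Γ := le_trans (le_max_right _ _) hℓ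
  have hr : max 1 (50 * m / (9 * cs)) ≤ √Γ := by
    have := Real.sqrt_le_sqrt hΓsq
    rwa [Real.sqrt_sq (le_trans zero_le_one (le_max_left _ _))] at this
  have hr50 : 50 * m / (9 * cs) ≤ √Γ := le_trans (le_max_right _ _) hr
  have hsΓ : 0 < √Γ := Real.sqrt_pos.mpr hΓpos
  obtain ⟨hr1, -, -, -, -, hsplit⟩ := gamma_facts hΓ1 hℓ1
  -- the registered geometry
  have hhs : 0 < cs * √Γ := by positivity
  have hcsρ : 4 * cs ≤ ρ := by linarith
  have h16d : 16 * (cs * √Γ / 4) ≤ ρ * √Γ := by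
    have := mul_le_mul_of_nonneg_right hcsρ hsΓ.le
    linarith
  have hL : 0 < Rb * √(Γ * Real.log Γ) := mul_pos hRb (Real.sqrt_pos.mpr (mul_pos hΓpos (by linarith)))
  have hd₀ : 0 < ρ * √Γ := by positivity
  have hR := quarter_plateau_condition hcs hm0 hΓpos hr50
  obtain ⟨F, hF1, hF2, hF3⟩ := hF j
  obtain ⟨G, hG1, hG2, hG3⟩ := hG j
  obtain ⟨U, hU1, hU2, hU3⟩ := quarter_core (hs := cs * √Γ) (L := Rb * √(Γ * Real.log Γ)) (d₀ := ρ * √Γ)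
    (Γ := Γ) (γ := γ) (X := X) (c := c) (Aa := Aa) (u := u) j (F := F) (G := G) hu (fun k => (hX k).1) (fun k => (hX k).2.1)
    hRb.le hRb2 (fun k => (hX k).2.2.2) (fun k => (hA k).1) hΛ (fun k => (hA k).2.1) hd₀
    (fun k hk τ σ => hsep j k (Ne.symm hk) τ σ) hF1 hF3 hF2 hG1 (fun w hw => (hG3 w hw).1) hG2 hhs hL h16d hR
  refine ⟨U, hU1, hU2, fun z hz => (hU3 z hz).trans ?_⟩
  -- the Γ-asymptotics of the explicit bound
  have h1 := coeff_sum_le (N := N) (γ := γ) (θ₀ := θ₀) hΓpos.le hγ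
  have hlg := quarter_log_term_le hcs hm0 hΓ1 hℓ1 hℓC
  have h2 := quarter_bound_abstract hcs hρ hr1 hℓ1 (rfl : cs * √Γ = cs * √Γ) (rfl : ρ * √Γ = ρ * √Γ) hlg
  have hS0 : 0 ≤ ∑ k, |Γ * γ k / (4 * Real.pi)| := Finset.sum_nonneg fun k _ => abs_nonneg _
  have hC₀ℓ : 0 ≤ C₀ * (Real.log Γ / √Γ) := mul_nonneg hC₀pos.le (div_nonneg (by linarith) hsΓ.le)
  have key : Γ * (Real.log Γ / √Γ) = √Γ * Real.log Γ := by
    rw [mul_div_left_comm, Real.div_sqrt, mul_comm]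
  have h4 : (∑ k, |Γ * γ k / (4 * Real.pi)|) * (C₀ * (Real.log Γ / √Γ)) ≤ Cu * √Γ * Real.log Γ := by
    refine (mul_le_mul_of_nonneg_right h1 hC₀ℓ).trans (le_of_eq ?_)
    have e : (N : ℝ) * (Γ * θ₀⁻¹ / (4 * Real.pi)) * (C₀ * (Real.log Γ / √Γ)) =
        (N : ℝ) * θ₀⁻¹ / (4 * Real.pi) * C₀ * (Γ * (Real.log Γ / √Γ)) := by ring
    rw [e, key, hCu]; ring
  exact (mul_le_mul_of_nonneg_left h2 hS0).trans h4

/-- **The registered stub `stub_stripPropagation : StripPropagation` of line `child_tangent_analytic_strip_L` (stmt-23320; shared verbatim with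
`child_tangent_analytic_strip`, stmt-28295), BY NAME over the Theorems-side verbatim copy** — at the REGISTERED quarter width. [folklore] -/
theorem stub_stripPropagation : StripPropagation :=
  stripPropagation_iff.mpr strip_propagation_quarter

end Summit.NavierStokesRegularity.NavierStokesRegularity.Theorems.StadiumStripPropagationQuarterProof

end
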